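import Summits.HubbardSuperconductivity.HubbardSuperconductivity.Theorems.AnisotropyChordTransferFibre3N1RowL2N13563

/-!
# Route `AnisotropyChord` / H0 rotor rung, LEVEL 2 row `N₁`: the cell `ν ∈ [0.013563, 0.014106]`, `a ∈ [0.2, 0.3]`

One cell of the ∀L ≥ 128 kernel certificate of the (KT-1″) trial-gap bound (piece A, stmt-HubbardSuperconductivity-23918), on the
column `colN13563` (brackets certified in `…N1RowL2N13563`): ★ `cellN13563A0200_n1 : n1CellCheckC colN13563 a₁ a₂ 2 (12/25) (30, 6) = true`
(the staged `RExpr` cell check of p2 g4–g5, one `decide`, ≈ 3 min), whence ★★ `trialGap_cellN13563A0200`: for every `L ≥ 128` and every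
ground two-magnon profile with `ν = λ₂/θ² ∈ [13563/1000000, 7053/500000]` and `a = Δf(x̂) ∈ [1/5, 3/10]`:  `(12/25)·U ≤ N₁`
(`…N1RowCellSound.trialGap_of_cellCheck`).  Compiled-evaluator forecast of the certified ratio on this cell: see the proposal note.
Generated by p2 g5's cells/mkfiles.py (HOME/hubbard-h0-rotor-p2/cells/).
Prover seat `hubbard-h0-rotor-p2` g5; helper for piece A = stmt-HubbardSuperconductivity-23918 of rung 19089
(`--supports`, helper class).  Nothing here proves superconductivity in the Hubbard model; one kernel-certified piece of ONE
conditional reduction (the GM₃ ∀L certificate, Level-2 row `N₁`); the rotor TARGET as originally worded stays FALSE (g15 verdict).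
Mathlib + the tree only; no sorry.
-/

set_option linter.dupNamespace false
set_option autoImplicit false

open Literature.Analysis.ValidatedNumerics

namespace Summit.HubbardSuperconductivity.HubbardSuperconductivity.Theorems.AnisotropyChord.Transfer.Fibre3.L2.N1

/-- ★ the staged `RExpr` cell check passes with `cmin = 12/25` on `a ∈ [1/5, 3/10]` over the column `colN13563`. -/
theorem cellN13563A0200_n1 : n1CellCheckC colN13563 ((1 : ℚ) / 5) ((3 : ℚ) / 10) 2 ((12 : ℚ) / 25) (30, 6) = true := by
  decide +kernel

/-- ★★ on this cell, for EVERY `L ≥ 128` and every ground profile: `(12/25)·U ≤ N₁`. -/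
theorem trialGap_cellN13563A0200 (L : ℕ) [NeZero L] (hL : 128 ≤ L) {Δ lam2 : ℝ} {f : Tor L → ℝ} (hΔ0 : 0 ≤ Δ) (hΔ1 : Δ < 1)
    (hf : IsGroundTwoMagnon L Δ lam2 f)
    (hν1 : (13563 : ℝ) / 1000000 ≤ lam2 / (2 * Real.pi / L) ^ 2) (hν2 : lam2 / (2 * Real.pi / L) ^ 2 ≤ (14106 : ℝ) / 1000000)
    (ha1 : ((1 : ℝ) / 5) ≤ Δ * f (K1 L)) (ha2 : Δ * f (K1 L) ≤ ((3 : ℝ) / 10)) :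
    ((12 : ℝ) / 25) * Uunit L Δ f ≤ trialGapN1 L Δ f := by
  have h := trialGap_of_cellCheck L colN13563 ((1 : ℚ) / 5) ((3 : ℚ) / 10) ((12 : ℚ) / 25) (30, 6) cellN13563A0200_n1 colN13563_check hL hΔ0 hΔ1 hf
    (by simpa [colN13563] using hν1) (by simpa [colN13563] using hν2) (by push_cast; simpa using ha1) (by push_cast; simpa using ha2)
  simpa using h

end Summit.HubbardSuperconductivity.HubbardSuperconductivity.Theorems.AnisotropyChord.Transfer.Fibre3.L2.N1
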